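import Summits.ABC.StewartYu.PadicG3SatLevels
import Summits.ABC.StewartYu.PadicG3StartR
import HarnessLib

/-!
# Cell abc-stewartyu, WP-L.P(odd) (crux r3 `PadicCoreOddRat`, stmt-ABC-20503): the START of the saturated frame — the SKEW FAMILY
# `𝔑 ∩ 𝔚` in θ-coordinates, its count, the Siegel step with an abstract monomial datum, and the level-`0` saturated invariant

`Summits/ABC/StewartYu/PadicG3SatStart.lean` — cell `abc-stewartyu` (HOME `run/shared/lean/pub/abc-stewartyu/`, design memo
HOME/p2/memo-07-WPLP-odd-Nframe-design.md §0 «WHAT N COSTS», §2 row «START»; seat p2-g6).  One definition (`satFam`) and theorems on `G3Setup`;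
no named fact, no parameters.

* `satFam F Lc sv = {μ ∈ box Lc : |ν(μ)ⱼ| ≤ svⱼ}` — Nesterenko's `𝔑 ∩ 𝔚` written in the θ-coordinates of the saturated basis (virtual half-sides
  `svⱼ`, θ-box `Lc`); **`card_box_le_card_satFam`** — for `svⱼ ≥ N·sⱼ` and `Lcₖ ≥ Σⱼ sⱼ|Cⱼₖ|` the map `λ ↦ λ ᵥ* C` embeds Matveev's
  integer box `box s` into it, so the landed count `∏(2sⱼ+1)` is a lower bound (memo: «the START count needs NO new lemma for correctness»);
* `exists_g3_siegel_gen` — the landed Siegel step `PadicG3SiegelGen.exists_g3_siegel` with the monomial clearing as an ABSTRACT per-equation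
  datum `(Dm e, Mm e)` (`PadicG3SatKStep.exists_int_clear_mul_coef_gen`);
* **`start_sat`** — twin of `PadicG3StartR.start_restricted`: slab/twist pigeonhole on `satFam` (`exists_slab_class`), Siegel with the virtual
  denominator `F.Dm (2sv) x`, and the level-`0` state `LvInvSatI F R₀ (unk L₀ 𝔏) (i.2 − μb) 1 pv (−Lc−μb) (2Lc) (−sv−ν(μb)) (2sv) P m {|x| ≤ X₀} T₀`.

WHAT THIS IS NOT: no parameter choice (the record supplies `Lc, sv, L₀, X₀, T₀, …`); no crux moves.

References: Yu. V. Nesterenko, LNM 1819 (2003) §3.4–3.5 (Prop 3.4, 3.7), (3.30), (4.6); K. Yu, Acta Math. 211 (2013) Lemma 4.2.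
-/

noncomputable section

open NormedSpace Finset Polynomial
open scoped Matrix
open Literature.NumberTheory.Transcendental
open Literature.NumberTheory.Transcendental.CW77.Setup (Tau tauNorm tauSet)
open scoped Nat

namespace Summit.ABC.StewartYu

namespace G3Setup

variable {p : ℕ} [Fact p.Prime] (S : G3Setup p)

/-! ### The skew family -/

/-- **The skew family** `{μ ∈ box Lc : |ν(μ)ⱼ| ≤ svⱼ ∀ j}` (`ν(μ) = μ ᵥ* F.U`): the exponent vectors, in the θ-coordinates of the saturated
basis, of the points of `𝔑` in the virtual box. [cite: Nesterenko2003, §3.5 (𝔑 ∩ 𝔚); shape only] -/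
def satFam (F : S.SatData) (Lc sv : Fin S.n → ℕ) : Finset (Fin S.n → ℤ) :=
  (S.box Lc).filter fun μ => ∀ j, |(μ ᵥ* F.U) j| ≤ (sv j : ℤ)

/-- Membership. [folklore] -/
theorem mem_satFam {F : S.SatData} {Lc sv : Fin S.n → ℕ} {μ : Fin S.n → ℤ} :
    μ ∈ S.satFam F Lc sv ↔ (∀ k, |μ k| ≤ Lc k) ∧ ∀ j, |(μ ᵥ* F.U) j| ≤ (sv j : ℤ) := by
  unfold satFam; rw [mem_filter, S.mem_box]

/-- `satFam ⊆ box Lc`. [folklore] -/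
theorem satFam_subset_box (F : S.SatData) (Lc sv : Fin S.n → ℕ) : S.satFam F Lc sv ⊆ S.box Lc := filter_subset _ _

/-- **The integer box embeds into the skew family**: for `N·sⱼ ≤ svⱼ` and `Σⱼ sⱼ|Cⱼₖ| ≤ Lcₖ`, `#box s ≤ #satFam F Lc sv` (via `λ ↦ λ ᵥ* C`,
injective because `C·U = N·1`). [cite: Nesterenko2003, §3.5 (ℤⁿ ⊆ 𝔑); shape only] -/
theorem card_box_le_card_satFam (F : S.SatData) {s Lc sv : Fin S.n → ℕ} (hsv : ∀ j, F.N * s j ≤ sv j)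
    (hLc : ∀ k, ∑ j, (s j : ℤ) * |F.C j k| ≤ (Lc k : ℤ)) : (S.box s).card ≤ (S.satFam F Lc sv).card := by
  classical
  refine card_le_card_of_injOn (fun lam => lam ᵥ* F.C) (fun lam hl => ?_) ?_
  · simp only [Finset.mem_coe] at hl ⊢
    rw [S.mem_box] at hl
    rw [S.mem_satFam]
    constructor
    · intro k
      have e : (lam ᵥ* F.C) k = ∑ j, lam j * F.C j k := rfl
      rw [e]
      calc |∑ j, lam j * F.C j k| ≤ ∑ j, |lam j * F.C j k| := abs_sum_le_sum_abs _ _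
        _ ≤ ∑ j, (s j : ℤ) * |F.C j k| := sum_le_sum fun j _ => by
            rw [abs_mul]; exact mul_le_mul_of_nonneg_right (hl j) (abs_nonneg _)
        _ ≤ (Lc k : ℤ) := hLc k
    · intro j
      rw [Matrix.vecMul_vecMul, F.hCU, Matrix.vecMul_smul, Matrix.vecMul_one, Pi.smul_apply, smul_eq_mul, abs_mul,
        abs_of_nonneg (by exact_mod_cast F.hN.le : (0 : ℤ) ≤ F.N)]
      have h1 : (F.N : ℤ) * |lam j| ≤ (F.N : ℤ) * s j := mul_le_mul_of_nonneg_left (hl j) (by exact_mod_cast F.hN.le)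
      have h2 : ((F.N * s j : ℕ) : ℤ) ≤ sv j := by exact_mod_cast hsv j
      push_cast at h2
      linarith
  · intro lam _ lam' _ h
    have h' : (lam ᵥ* F.C) ᵥ* F.U = (lam' ᵥ* F.C) ᵥ* F.U := by
      have h0 : lam ᵥ* F.C = lam' ᵥ* F.C := h
      rw [h0]
    rw [Matrix.vecMul_vecMul, Matrix.vecMul_vecMul, F.hCU, Matrix.vecMul_smul, Matrix.vecMul_smul, Matrix.vecMul_one,
      Matrix.vecMul_one] at h'
    funext j
    have hj := congrFun h' j
    simp only [Pi.smul_apply, smul_eq_mul] at hj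
    have hN0 : (F.N : ℤ) ≠ 0 := by exact_mod_cast F.hN.ne'
    exact mul_left_cancel₀ hN0 hj

/-! ### The Siegel step with an abstract monomial datum -/

variable {ι : Type*} (R : ι → ℚ[X]) (v : ι → Fin S.n → ℤ)

/-- **The Siegel step for the class family, abstract monomial datum**: as `PadicG3SiegelGen.exists_g3_siegel` with the monomial clearing
`Dm e·∏ θⱼ^{vᵢⱼ x} ∈ ℤ`, `|·| ≤ Mm e` supplied per equation point. [cite: Nesterenko2003, Prop 3.9] [cite: Yu2013, Lemma 4.2] -/
theorem exists_g3_siegel_gen [DecidableEq ι] (B : Finset ι) (E : Finset (ℤ × Tau S.n)) (hE : E.Nonempty)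
    (hcard : 2 * E.card ≤ B.card)
    (den₀ : ℤ × Tau S.n → ℕ) (hden₀ : ∀ e ∈ E, 1 ≤ den₀ e) (M₀ : ℤ × Tau S.n → ℤ)
    (hR : ∀ e ∈ E, ∀ i ∈ B,
      ∃ z₀ : ℤ, (den₀ e : ℚ) * (hasseDeriv e.2.1 (R i)).eval (e.1 : ℚ) = z₀ ∧ |z₀| ≤ M₀ e)
    {Xb : ℤ} (hX : ∀ i ∈ B, ∀ k, |S.𝔛 (v i) k| ≤ Xb)
    (Dm : ℤ → ℕ) (hDm : ∀ x, 1 ≤ Dm x) (Mm : ℤ → ℤ)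
    (hm : ∀ x : ℤ, ∀ i ∈ B, ∃ z₂ : ℤ, ((Dm x : ℕ) : ℚ) * ∏ j, S.α j ^ (v i j * x) = z₂ ∧ |z₂| ≤ Mm x)
    {Amax : ℝ} (hAmax : 1 ≤ Amax)
    (hA : ∀ e ∈ E, (M₀ e : ℝ) * (Xb : ℝ) ^ (∑ k, e.2.2 k) * (Mm e.1 : ℝ) ≤ Amax) :
    ∃ pv : ι → ℤ, (∀ i, pv i ≠ 0 → i ∈ B) ∧ (∃ i, pv i ≠ 0) ∧
      (∀ i, |pv i| ≤ ⌈(B.card : ℝ) * Amax⌉) ∧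
      ∀ e ∈ E, S.g3φ R v B pv e.2 e.1 = 0 := by
  classical
  -- the system: coefficient of the unknown `i` in the equation `e = (x, τ)`
  set coeff : ℤ × Tau S.n → ι → ℚ := fun e i =>
    (hasseDeriv e.2.1 (R i)).eval (e.1 : ℚ) * S.zγpow v i e.2.2 * ∏ j, S.α j ^ (v i j * e.1) with hcoeff
  -- the clearing denominators
  set Dc : ℤ × Tau S.n → ℕ := fun e => den₀ e * (S.b S.j₀).natAbs ^ (∑ k, e.2.2 k) * Dm e.1 with hDc
  have hb1 : 1 ≤ (S.b S.j₀).natAbs := Int.natAbs_pos.mpr S.bj₀_ne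
  have hDpos : ∀ e ∈ E, 0 < Dc e := by
    intro e he
    have : 1 ≤ Dc e := one_le_mul (one_le_mul (hden₀ e he) (Nat.one_le_pow _ _ hb1)) (hDm e.1)
    omega
  -- integrality and size of the cleared coefficients
  have hclear : ∀ e ∈ E, ∀ i ∈ B, ∃ z : ℤ, (Dc e : ℚ) * coeff e i = z ∧
      |z| ≤ M₀ e * Xb ^ (∑ k, e.2.2 k) * Mm e.1 := by
    intro e he i hi
    exact S.exists_int_clear_mul_coef_gen R v i e.2 e.1 (hR e he i hi) (hX i hi) (hm e.1 i hi)
  have hint : ∀ e ∈ E, ∀ i ∈ B, ∃ z : ℤ, (Dc e : ℚ) * coeff e i = z :=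
    fun e he i hi => by obtain ⟨z, hz, _⟩ := hclear e he i hi; exact ⟨z, hz⟩
  have hAbound : ∀ e ∈ E, ∀ i ∈ B, ((|(Dc e : ℚ) * coeff e i| : ℚ) : ℝ) ≤ Amax := by
    intro e he i hi
    obtain ⟨z, hz, hzle⟩ := hclear e he i hi
    rw [hz]
    push_cast
    have h1 : |(z : ℝ)| ≤ (M₀ e : ℝ) * (Xb : ℝ) ^ (∑ k, e.2.2 k) * (Mm e.1 : ℝ) := by
      have := (Int.cast_le (R := ℝ)).mpr hzle
      push_cast at this
      exact this
    exact h1.trans (hA e he)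
  obtain ⟨pv, hsupp, hne, hbound, hsol⟩ :=
    SiegelFinset.exists_int_vec_of_finset B E hE hcard coeff Dc hDpos hint hAmax hAbound
  refine ⟨pv, hsupp, hne, hbound, fun e he => ?_⟩
  have h := hsol e he
  unfold g3φ
  rw [← h]
  refine Finset.sum_congr rfl fun i _ => ?_
  simp only [hcoeff]
  ring

/-! ### The START of the saturated frame -/

variable {S}

/-- **THE START OF THE SATURATED FRAME** (restricted equation set): pigeonhole a slab/twist class `𝔏` of the skew family `satFam F Lc sv`,
solve the level-`0` equations `(x, τ) ∈ Icc(−X₀,X₀) ×ˢ tauSetR` by Siegel (unknowns `unk L₀ 𝔏`, coefficients cleared by `den₀`,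
`|b_{j₀}|^{|t|}` and the VIRTUAL monomial denominator `F.Dm (2sv) x`), and read off the level-`0` saturated invariant with base point `μb ∈ 𝔏`:
θ-box `[−Lc−μb, Lc−μb]`, virtual box `[−sv−ν(μb), sv−ν(μb)]`. [cite: Nesterenko2003, §3.4–3.5, Prop 3.9, (4.6)] [cite: Yu2013, Lemma 4.2] -/
theorem start_sat (F : S.SatData) (m : ℕ) (Lc sv : Fin S.n → ℕ) (L₀ : ℕ) (R₀ : ℕ → ℚ[X]) (X₀ T₀ : ℕ) (hT₀ : 1 ≤ T₀)
    (hΛm : ‖S.Λ / (S.b S.j₀ : ℚ_[p])‖ ≤ (p : ℝ)⁻¹ ^ (m + 1))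
    (E : Finset (ℤ × Tau S.n)) (hEdef : E = Icc (-(X₀ : ℤ)) X₀ ×ˢ tauSetR S.n S.j₀ T₀)
    (hcount : 2 * E.card * ((p - 1) * p ^ m) ≤ (L₀ + 1) * (S.satFam F Lc sv).card)
    (den₀ : ℤ × Tau S.n → ℕ) (hden₀ : ∀ e ∈ E, 1 ≤ den₀ e) (M₀ : ℤ × Tau S.n → ℤ)
    (hR : ∀ e ∈ E, ∀ ℓ₀ ≤ L₀, ∃ z₀ : ℤ, (den₀ e : ℚ) * (hasseDeriv e.2.1 (R₀ ℓ₀)).eval (e.1 : ℚ) = z₀ ∧ |z₀| ≤ M₀ e)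
    {Xb : ℤ} (hX : ∀ w : Fin S.n → ℤ, (∀ k, |w k| ≤ ((2 * Lc k : ℕ) : ℤ)) → ∀ k, |S.𝔛 w k| ≤ Xb)
    {Amax : ℝ} (hAmax : 1 ≤ Amax)
    (hA : ∀ e ∈ E, (M₀ e : ℝ) * (Xb : ℝ) ^ (∑ k, e.2.2 k) * ((F.Dm (fun j => 2 * sv j) e.1 : ℝ)) ^ 2 ≤ Amax) :
    ∃ (𝔏 : Finset (Fin S.n → ℤ)) (μb : Fin S.n → ℤ) (pv : ℕ × (Fin S.n → ℤ) → ℤ),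
      𝔏 ⊆ S.satFam F Lc sv ∧ μb ∈ 𝔏 ∧
      S.LvInvSatI F (fun i => R₀ i.1) (S.unk L₀ 𝔏) (fun i => i.2 - μb) (fun _ => 1) pv
        (fun k => -(Lc k : ℤ) - μb k) (fun k => 2 * Lc k) (fun j => -(sv j : ℤ) - (μb ᵥ* F.U) j) (fun j => 2 * sv j)
        ⌈((S.unk L₀ 𝔏).card : ℝ) * Amax⌉ m {x : ℤ | |x| ≤ (X₀ : ℤ)} T₀ := by
  classical
  have hp : p.Prime := Fact.out
  obtain ⟨𝔏, h𝔏fam, htw, hslab, hcard𝔏⟩ := S.exists_slab_class m (S.satFam F Lc sv)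
  have hpm : 0 < (p - 1) * p ^ m := Nat.mul_pos (by have := S.hp3; omega) (pow_pos hp.pos m)
  have hE : E.Nonempty := by
    refine ⟨((0 : ℤ), ((0 : ℕ), fun _ => (0 : ℕ))), ?_⟩
    rw [hEdef, mem_product, mem_Icc, mem_tauSetR]
    refine ⟨⟨by omega, by omega⟩, ?_, rfl⟩
    unfold tauNorm; simp; omega
  have hEpos : 0 < E.card := card_pos.mpr hE
  have h𝔏ne : 𝔏.Nonempty := by
    rw [← Finset.card_pos]
    by_contra h0
    push Not at h0
    have : 𝔏.card = 0 := by omega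
    rw [this, mul_zero] at hcard𝔏
    have h1 : (S.satFam F Lc sv).card = 0 := by omega
    rw [h1, mul_zero] at hcount
    have : 0 < 2 * E.card * ((p - 1) * p ^ m) := Nat.mul_pos (by omega) hpm
    omega
  obtain ⟨μb, hμb⟩ := h𝔏ne
  have hcard : 2 * E.card ≤ (S.unk L₀ 𝔏).card := by
    rw [S.card_unk]
    have h1 : (L₀ + 1) * (S.satFam F Lc sv).card ≤ (L₀ + 1) * ((p - 1) * p ^ m * 𝔏.card) := Nat.mul_le_mul_left _ hcard𝔏
    have h2 : 2 * E.card * ((p - 1) * p ^ m) ≤ ((L₀ + 1) * 𝔏.card) * ((p - 1) * p ^ m) := by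
      calc 2 * E.card * ((p - 1) * p ^ m) ≤ (L₀ + 1) * ((p - 1) * p ^ m * 𝔏.card) := hcount.trans h1
        _ = ((L₀ + 1) * 𝔏.card) * ((p - 1) * p ^ m) := by ring
    exact Nat.le_of_mul_le_mul_right h2 hpm
  -- boxes of the members of the class
  have hmem : ∀ i ∈ S.unk L₀ 𝔏, i.2 ∈ S.satFam F Lc sv := fun i hi =>
    h𝔏fam ((mem_product.mp (by unfold unk at hi; exact hi)).2)
  have hμbfam := S.mem_satFam.mp (h𝔏fam hμb)
  have hcbox : ∀ i ∈ S.unk L₀ 𝔏, ∀ k, |(i.2 - μb) k| ≤ ((2 * Lc k : ℕ) : ℤ) := by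
    intro i hi k
    have h1 := (S.mem_satFam.mp (hmem i hi)).1 k
    have h2 := hμbfam.1 k
    simp only [Pi.sub_apply]
    rw [abs_le] at h1 h2 ⊢
    push_cast
    constructor <;> omega
  have hvbox : ∀ i ∈ S.unk L₀ 𝔏, ∀ j, |((i.2 - μb) ᵥ* F.U) j| ≤ ((2 * sv j : ℕ) : ℤ) := by
    intro i hi j
    have h1 := (S.mem_satFam.mp (hmem i hi)).2 j
    have h2 := hμbfam.2 j
    rw [Matrix.sub_vecMul, Pi.sub_apply]
    rw [abs_le] at h1 h2 ⊢
    push_cast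
    constructor <;> omega
  have hRB : ∀ e ∈ E, ∀ i ∈ S.unk L₀ 𝔏,
      ∃ z₀ : ℤ, (den₀ e : ℚ) * (hasseDeriv e.2.1 (R₀ i.1)).eval (e.1 : ℚ) = z₀ ∧ |z₀| ≤ M₀ e := by
    intro e he i hi
    have hi1 : i.1 ≤ L₀ := by
      unfold unk at hi
      have := (mem_product.mp hi).1
      rw [mem_range] at this; omega
    exact hR e he i.1 hi1
  have hXB : ∀ i ∈ S.unk L₀ 𝔏, ∀ k, |S.𝔛 (i.2 - μb) k| ≤ Xb := fun i hi k => hX (i.2 - μb) (hcbox i hi) k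
  obtain ⟨pv, hsupp, hne, hbd, hsol⟩ := S.exists_g3_siegel_gen (fun i : ℕ × (Fin S.n → ℤ) => R₀ i.1) (fun i => i.2 - μb)
    (S.unk L₀ 𝔏) E hE hcard den₀ hden₀ M₀ hRB hXB (F.Dm fun j => 2 * sv j) (F.one_le_Dm _)
    (fun x => ((F.Dm (fun j => 2 * sv j) x : ℤ)) ^ 2) (F.monomialDatum_of_vbox hvbox) hAmax
    (fun e he => by have := hA e he; push_cast at this ⊢; exact this)
  refine ⟨𝔏, μb, pv, h𝔏fam, hμb, ?_⟩
  obtain ⟨i₀, hi₀⟩ := hne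
  refine ⟨⟨⟨i₀, hsupp i₀ hi₀, hi₀⟩, fun i _ => hbd i, ?_, ?_, fun _ => Or.inl rfl, ?_, ?_, ?_, ?_⟩, ?_, ?_⟩
  · intro k
    have h2 := hμbfam.1 k
    rw [abs_le] at h2
    push_cast
    constructor <;> omega
  · intro i hi k
    have h1 := (S.mem_satFam.mp (hmem i hi)).1 k
    rw [abs_le] at h1
    simp only [Pi.sub_apply]
    push_cast
    constructor <;> omega
  · intro i hi
    have hi2 : i.2 ∈ 𝔏 := (mem_product.mp (by unfold unk at hi; exact hi)).2
    rw [S.cls_sub_eq_one htw hi2 hμb]; norm_num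
  · intro i hi
    have hi2 : i.2 ∈ 𝔏 := (mem_product.mp (by unfold unk at hi; exact hi)).2
    exact S.norm_E_sub_le_depth hslab hi2 hμb hΛm
  · intro i hi i' hi'
    have hi2 : i.2 ∈ 𝔏 := (mem_product.mp (by unfold unk at hi; exact hi)).2
    have hi2' : i'.2 ∈ 𝔏 := (mem_product.mp (by unfold unk at hi'; exact hi')).2
    rw [← S.Lsum_sub]
    have : i.2 - μb - (i'.2 - μb) = i.2 - i'.2 := by abel
    rw [this, S.Lsum_sub]
    exact hslab i.2 hi2 i'.2 hi2'
  · -- vanishing: charged equations by Siegel, the others trivially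
    intro x hx τ hτ
    have hpvx : pvx (fun _ : ℕ × (Fin S.n → ℤ) => (1 : ℤ)) pv x = pv := by
      funext i; unfold pvx; rw [one_pow, one_mul]
    rw [hpvx]
    by_cases hj : τ.2 S.j₀ = 0
    · have he : (x, τ) ∈ E := by
        rw [hEdef, mem_product, mem_Icc, mem_tauSetR]
        have hx' : |x| ≤ (X₀ : ℤ) := hx
        rw [abs_le] at hx'
        exact ⟨⟨hx'.1, hx'.2⟩, hτ, hj⟩
      exact hsol (x, τ) he
    · exact S.g3φ_eq_zero_of_ne (fun i : ℕ × (Fin S.n → ℤ) => R₀ i.1) (fun i => i.2 - μb) (S.unk L₀ 𝔏) pv hj x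
  · -- the virtual interval contains `0`
    intro j
    have h2 := hμbfam.2 j
    rw [abs_le] at h2
    push_cast
    constructor <;> omega
  · -- the virtual box
    intro i hi j
    have h1 := (S.mem_satFam.mp (hmem i hi)).2 j
    rw [abs_le] at h1
    rw [Matrix.sub_vecMul, Pi.sub_apply]
    push_cast
    constructor <;> omega

end G3Setup

end Summit.ABC.StewartYu

end
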